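import Summits.BirchSwinnertonDyer.BirchSwinnertonDyer.Theorems.MordellShaFreeCutThreeAdicHsiehDescent
import Summits.BirchSwinnertonDyer.BirchSwinnertonDyer.Theorems.ClassRecordThreeHsiehDescentTateSen
import Summits.BirchSwinnertonDyer.Rank1Residual.X11b.AnticyclotomicEmbedding
import Summits.BirchSwinnertonDyer.BirchSwinnertonDyer.Theorems.MordellShaFreeCutJZeroConductorThree
import HarnessLib

set_option linter.dupNamespace false
set_option autoImplicit false

/-! # Route `MordellShaFreeCut` (rung S2b) — the `R₀`-DESCENT residual `ThreeAdicHsiehDescent` of (LB-exist) at the additive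
prime `3` from the PRINTED Tate–Sen theorem + a value-reciprocity clause (x11b3's landed K4″/sharp engine RE-RUN at `j = 0`,
`3² ∣ N`) — PART 1 of 2: the kernel (theorems only)

Cell `bsd-cn100`, prover seat `bsd-cn100-s2b-c3` (g8). Supports, does not close, stmt-BirchSwinnertonDyer-19160 (crux B);
serves the existence half of stmt-BirchSwinnertonDyer-19159's registered stub `stub_threeAdicBDPElementExistsWithValue` (v6bq).
Plan g15 RULING-3 (e1)/(f) + plan g16 RULING-1 (4) asked for «`ThreeAdicHsiehDescent` (p481496) as typed, proved outright or
reduced to Galois-equivariance of the any-level Hsieh frame under `Aut(ℂ₃/ℚ̂₃^ur)` + Ax–Sen–Tate» (KERNEL-CENSUS-S2b-g7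
§descent (IV)). Team x11b3 (cell `bsd-stepL`, seat `bsd-stepL-bdp`) PROVED exactly that reduction for their `3 ∥ N` node
`X11b.Three.HsiehDescentAt₃` (`Theorems/ClassRecordThreeHsiehDescentSharp.lean`,
`X11b.Three.BdpSeat.hsiehDescentAt₃_of_sharpValueReciprocity_of_tateSenCharacter`); their argument is W-, N- and
reduction-type-GENERIC except for two uses of their extra binders — `3 ∣ N` (there from `ClassX11b W 3`; HERE from `j = 0`,
companion file `MordellShaFreeCutJZeroConductorThree`: every `j = 0` curve over `ℚ` is bad at `3`) and
`e(v|3) = f(v|3) = 1` (there binders; HERE from «`3` splits in `K`», `X11b.degreeOne_of_splitsIn`) — so it is RE-RUN here,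
step for step, on the binders of `ThreeAdicHsiehDescent` (`W.j = 0`, Heegner hypothesis, `3` split, `3 ∈ v`, EVERY imaginary
quadratic `K` — no `Odd d_K`, no `ClassX11b`, no `Surj`), with the value-reciprocity clause as an EXPLICIT HYPOTHESIS `hVR`
spelled out inline (x11b3's SHARP (VR-B_U)|κ shape on our binders; PART 2, `MordellShaFreeCutThreeAdicBDPValueReciprocity.lean`,
names it `ThreeAdicBDPValueReciprocity` and carries the censuses).

THEOREM `threeAdicHsiehDescent_of_tateSenCharacter_of_sharpValueReciprocity (hTS) (hVR) : ThreeAdicHsiehDescent` (PROVED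
reduction; `hTS = Literature.NumberTheory.PAdicHodge.TateSenCharacterVanishing 3`, Tate 1967 §3.3 Thm 2 = Brinon–Conrad Thm 2.2.7,
tree NAMED FACT, NOT asserted; `hVR` NOT discharged). PROOF = x11b3's K4″ with step 5 sharpened, verbatim up to the two binder
supplies: normalise `E := ι′⁻¹(C)⁻¹·Q`; base range point (`X11b.exists_interpolationCharacter`); family-form twist relation
`T_τ Ē = (1+T)^{a(τ)} Ē` on `U_m` (`exists_twist_of_family`, fed by `hVR`); Tate–Sen kills the twist exponent on INERTIA
(`Theorems.twistExponent_eq_zero_on_inertia_of_tateSenCharacter`); so `T_τ Ē = Ē` on inertia and the coefficients of `E` lie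
in `R₀` (`mem_unrIntegers_of_forall_inertia_fixed_family` = Ax–Sen–Tate for `ℚ̂₃^ur`, tree theorem); `(T_τ θ)^n = θ^n` on
inertia at every type `n` with a non-zero value; period root `β·r⁴`, `r ∈ R₀ˣ` (`exists_period_root`); new periods `(Ω/ρ, r)`;
Hsieh's display with `C = 1`; Castella's display by x11b3's glue `X11b.Three.exists_isBDPLFunction_of_hsiehDisplay`. The
degenerate witness `Q = 0` is handled separately (all values vanish; frame `(Ω_K, 1, 0)`).

HONEST FRAMING: a CONDITIONAL reduction; nothing here proves Tate–Sen, the reciprocity clause, the descent, (LB-wan), (LB-bdp),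
crux A, crux B, the leaf, Sylvester's conjecture or any case of BSD. PARTITION: none — RANK axis.
References: [Tate1967] §3.3 Thm 2; [BrinonConrad2009] Thm 2.2.7; [Hsieh2014] Thm. 1; [CastellaHsieh2018] Def. 3.5,
Prop. 3.6; [Castella2018] Thm. 3.1; [BertoliniDarmonPrasanna2013] Thm. 5.4, Lemma 5.3; [HidaTilouine1993] Thm. 1.1. -/

noncomputable section

open scoped NumberField Topology Classical
open Filter NumberField IsDedekindDomain Field PowerSeries WeierstrassCurve
open Literature.NumberTheory.GaloisRepresentations Literature.NumberTheory.EllipticCurves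
  Literature.NumberTheory.EllipticCurves.ModularForms Literature.NumberTheory.QuadraticFields
open Summit.BirchSwinnertonDyer.Rank1Residual Summit.BirchSwinnertonDyer.Rank1Residual.X11b
  Summit.BirchSwinnertonDyer.Rank1Residual.X11b.Three
open Summit.BirchSwinnertonDyer.Rank1Residual.X11b.LambdaSupply
  Summit.BirchSwinnertonDyer.Rank1Residual.X11b.Three.LambdaSupply
  Summit.BirchSwinnertonDyer.Rank1Residual.X11b.Three.RangeTransport
open Summit.BirchSwinnertonDyer.Rank1Residual.X11b.PadicComplexTransport (continuous_algEquiv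
  mem_unrIntegers_of_forall_inertia_fixed_family mem_fracUnr_of_forall_inertia_fixed_family)
open Literature.NumberTheory.PAdicHodge (TateSenCharacterVanishing)
open Summit.BirchSwinnertonDyer.BirchSwinnertonDyer.Theorems.MordellShaFreeCutThreeAdicHsiehDescent (ThreeAdicHsiehDescent)

namespace Summit.BirchSwinnertonDyer.BirchSwinnertonDyer.Theorems.MordellShaFreeCutThreeAdicHsiehDescentOfValueReciprocity

/-! ## 1. The descent from the printed Tate–Sen theorem and the value-reciprocity clause -/

/-- **`ThreeAdicHsiehDescent` ⟸ {the PRINTED Tate–Sen theorem, the SHARP value-reciprocity clause}.** `hTS` = the named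
fact `TateSenCharacterVanishing 3` (Tate 1967 §3.3 Thm 2 / Brinon–Conrad Thm 2.2.7; NOT asserted); `hVR` = for every datum of
the node (`W/ℚ` globally minimal with `j = 0`, `f` its newform of level `N = N_W`, `K` imaginary quadratic with the Heegner
hypothesis for `N` and `3` split, `v ∋ 3`, `ι′` inducing `v`, `κ` anticyclotomic) some `Ω ≠ 0`, `m ≥ 1`, `3 ∤ m` with exact
reciprocity `σ(bdpInterpolationValue 3 f v χ n Ω) = bdpInterpolationValue 3 f v χ^σ n Ω` for all `τ` fixing `μ_m`, all
`σ ∈ Aut(ℂ/ℚ)` over `τ`, on the everywhere-unramified `χ` of type `(n, −n)`, `n > 0`, factoring through `κ` (x11b3's SHARP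
(VR-B_U)|κ; the shape of BDP13 Thm. 5.4 / Lemma 5.3 + Katz–Hida–Tilouine; NOT discharged here). PROOF = x11b3's
`hsiehDescentAt₃_of_sharpValueReciprocity_of_tateSenCharacter` on the `j = 0` binders: `3 ∣ N` from
`three_dvd_conductorNorm_of_j_eq_zero`, `e(v|3) = f(v|3) = 1` from `X11b.degreeOne_of_splitsIn`; normalised series
`E = ι′⁻¹(C)⁻¹·Q`, family-form twist relations on `U_m` from `hVR`, twist exponent killed on inertia by Tate–Sen, coefficients
in `R₀` by Ax–Sen–Tate for `ℚ̂₃^ur` (`mem_unrIntegers_of_forall_inertia_fixed_family`), period root, new periods, Hsieh's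
display with `C = 1`, then Castella's display by `X11b.Three.exists_isBDPLFunction_of_hsiehDisplay`. CONDITIONAL on both
hypotheses; nothing discharged; the node stays OPEN modulo them.
[cite: Hsieh2014, Thm. 1 (arXiv:1112.1580 pp. 3–4)] [cite: CastellaHsieh2018, Def. 3.5 and Prop. 3.6]
[cite: BrinonConrad2009, Thm. 2.2.7] [cite: Tate1967, §3.3 Theorem 2]
[cite: BertoliniDarmonPrasanna2013, Thm. 5.4 and Lemma 5.3 (shape of `hVR` only; nothing asserted)] -/
theorem threeAdicHsiehDescent_of_tateSenCharacter_of_sharpValueReciprocity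
    (hTS : TateSenCharacterVanishing 3)
    (hVR : ∀ (W : WeierstrassCurve ℚ) [W.IsElliptic] [W.IsGloballyMinimal], W.j = 0 →
      ∀ (ι' : PadicAlgCl 3 ≃+* ℂ) (K : Type) [Field K] [NumberField K] (v : HeightOneSpectrum (𝓞 K))
        (κ : ZpExtension K 3) {N : ℕ} [NeZero N] (f : CuspForm (CongruenceSubgroup.Gamma0 N) 2),
        IsNewformOf W f → W.conductorNorm ℤ = N → IsImaginaryQuadratic K → SatisfiesHeegnerHypothesis N K →
        ((Ideal.span {(3 : ℤ)}).primesOver (𝓞 K)).ncard = 2 → ((3 : ℕ) : 𝓞 K) ∈ v.asIdeal →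
        (∀ (w : InfinitePlace K) (k : 𝓞 K), k ∈ v.asIdeal ↔ ‖ι'.symm (w.embedding (k : K))‖ < 1) →
        κ.IsAnticyclotomic →
        ∃ Ω : ℂ, Ω ≠ 0 ∧ ∃ m : ℕ, 0 < m ∧ ¬ 3 ∣ m ∧
          (∀ (τ : PadicAlgCl 3 ≃ₐ[ℚ_[3]] PadicAlgCl 3) (σ : ℂ ≃ₐ[ℚ] ℂ),
            (∀ ζ : PadicAlgCl 3, ζ ^ m = 1 → τ ζ = ζ) →
            (∀ z : PadicAlgCl 3, σ (ι' z) = ι' (τ z)) →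
            ∀ (χ : HeckeCharacter K) (n : ℕ), 0 < n →
              (∀ w : HeightOneSpectrum (𝓞 K), χ.IsUnramifiedAt w) →
              ∀ hχ : χ.HasInfinityType (fun _ ↦ (n : ℤ)) (fun _ ↦ -(n : ℤ)),
                ∀ r : FramedGaloisRep K (PadicAlgCl 3) 1, IsPAdicAvatarOf ι' χ r → FactorsThroughZp κ r →
                  σ (bdpInterpolationValue 3 f v χ n Ω) =
                    bdpInterpolationValue 3 f v (hχ.autConj σ) n Ω)) :
    ThreeAdicHsiehDescent := by
  intro W _ _ hj K _ _ N _ Dt 𝔭 κ γ hγF hN hKiq hHeeg hsplit h3𝔭 hκa ι' hι𝔭 A ΩK C Ωpu Q hA hΩK hC hQ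
  haveI : Fact (Nat.Prime 3) := ⟨Nat.prime_three⟩
  haveI : IsNonarchimedeanLocalField ℚ_[3] :=
    Literature.NumberTheory.GaloisRepresentations.Padic.isNonarchimedeanLocalField_holds 3
  have hγ : κ.IsTopGenerator γ := hγF.out
  set f := Dt.f with hfdef
  have hf : IsNewformOf W f := Dt.isNewformOf
  have h3N : 3 ∣ N := hN ▸ MordellShaFreeCutJZeroConductorThree.three_dvd_conductorNorm_of_j_eq_zero W hj
  have hKreal : ∀ w : InfinitePlace K, ¬ w.IsReal := not_isReal_of_isImaginaryQuadratic hKiq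
  have hK2 : Module.finrank ℚ K = 2 := hKiq.1
  obtain ⟨hram, hdeg⟩ :
      𝔭.asIdeal.ramificationIdx (𝓞 ℚ) = 1 ∧ 𝔭.asIdeal.inertiaDeg (𝓞 ℚ) = 1 :=
    degreeOne_of_splitsIn (K := K) (p := 3) hK2 hsplit h3𝔭
  -- the unit period `Ω_p ∈ R₀ˣ` as an element of `ℂ₃` of norm one
  set Ωp : ℂ_[3] := ((Ωpu : unrIntegers 3) : ℂ_[3]) with hΩpdef
  have hΩp : ‖Ωp‖ = 1 := (unrIntegers.isUnit_iff_norm_eq_one _).1 Ωpu.isUnit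
  obtain ⟨Ω, hΩ, m, hm, h3m, hVRB⟩ := hVR W hj ι' K 𝔭 κ f hf hN hKiq hHeeg hsplit h3𝔭 hι𝔭 hκa
  -- the open subgroup `U_m = Gal(ℚ̄₃/ℚ₃(μ_m))` contains the inertia group
  have hPI : ∀ τ : PadicAlgCl 3 ≃ₐ[ℚ_[3]] PadicAlgCl 3,
      (∀ ζ : PadicAlgCl 3, (∃ m : ℕ, 0 < m ∧ ¬ 3 ∣ m ∧ ζ ^ m = 1) → τ ζ = ζ) →
      ∀ ζ : PadicAlgCl 3, ζ ^ m = 1 → τ ζ = ζ := fun τ h ζ hζ ↦ h ζ ⟨m, hm, h3m, hζ⟩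
  set CC : ℂ_[3] := ((ι'.symm C : PadicAlgCl 3) : ℂ_[3]) with hCC
  have hCC0 : CC ≠ 0 := fun h ↦ by rw [h, norm_zero] at hC; exact zero_ne_one hC
  have hA' : (A : ℂ) ≠ 0 := by exact_mod_cast hA.ne'
  have hΘ0 : ((((3 : ℕ) : ℂ) / (16 * (A : ℂ) ^ 2)) * (Ω / ΩK) ^ 4) ≠ 0 :=
    mul_ne_zero (div_ne_zero (by norm_num) (mul_ne_zero (by norm_num) (pow_ne_zero 2 hA')))
      (pow_ne_zero 4 (div_ne_zero hΩ hΩK))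
  set θ : ℂ_[3] := ((ι'.symm ((((3 : ℕ) : ℂ) / (16 * (A : ℂ) ^ 2)) * (Ω / ΩK) ^ 4) : PadicAlgCl 3) :
    ℂ_[3]) * Ωp ^ 4 with hθ
  have hΩp0 : Ωp ≠ 0 := fun h ↦ by rw [h, norm_zero] at hΩp; exact zero_ne_one hΩp
  have hθ0 : θ ≠ 0 := by
    refine mul_ne_zero ?_ (pow_ne_zero 4 hΩp0)
    rw [PadicComplex.coe_eq, map_ne_zero_iff _ (algebraMap (PadicAlgCl 3) ℂ_[3]).injective,
      map_ne_zero_iff _ ι'.symm.injective]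
    exact hΘ0
  -- ## 1. The extensions `T_τ`, their coefficient maps, and `σ_τ = ι′ τ ι′⁻¹`
  choose T hT hTτ using fun τ : PadicAlgCl 3 ≃ₐ[ℚ_[3]] PadicAlgCl 3 ↦ exists_continuous_extension τ
  choose φ hφ using fun τ : PadicAlgCl 3 ≃ₐ[ℚ_[3]] PadicAlgCl 3 ↦
    exists_restrict_padicComplexInt (hT τ) (hTτ τ)
  have hσex : ∀ τ : PadicAlgCl 3 ≃ₐ[ℚ_[3]] PadicAlgCl 3, ∃ σ : ℂ ≃ₐ[ℚ] ℂ,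
      ∀ z, σ (ι' z) = ι' (τ z) := fun τ ↦ by
    obtain ⟨σ, hσ⟩ := exists_algEquiv_eq_ringEquiv
      (ι'.symm.trans ((τ : PadicAlgCl 3 ≃+* PadicAlgCl 3).trans ι'))
    exact ⟨σ, fun z ↦ by rw [hσ]; simp⟩
  choose σ hστ using hσex
  have hσK : ∀ τ (φ' : K →+* ℂ) (k : K), σ τ (φ' k) = φ' k := by
    intro τ φ' k
    have h1 := algEquiv_apply_embedding_eq hK2 (embAt K 3 𝔭 h3𝔭 hram hdeg) τ
      (ι'.symm.toRingHom.comp φ') k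
    have h2 := hστ τ (ι'.symm (φ' k))
    rw [ι'.apply_symm_apply] at h2
    rw [h2]
    change ι' (τ (ι'.symm (φ' k))) = φ' k
    rw [show τ (ι'.symm (φ' k)) = ι'.symm (φ' k) from h1, ι'.apply_symm_apply]
  -- ## 2. A base range point with `‖u − 1‖ < 1/3`, `u ≠ 1`
  obtain ⟨χ₀, m₀, ψ₀, hm₀, hunr₀, hχ₀, hav₀, hfac₀, hlt₀, hne₀⟩ :=
    exists_interpolationCharacter (p := 3) (by norm_num) ι' K κ hKiq hκa γ hγ
  rw [avatarValueAt_unitsChar] at hlt₀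
  simp_rw [avatarValueAt_unitsChar] at hne₀
  obtain ⟨k, hk⟩ : ∃ k : ℕ,
      ‖(((ψ₀ γ : (PadicAlgCl 3)ˣ) : PadicAlgCl 3) : ℂ_[3]) ^ 3 ^ k - 1‖ < ((3 : ℕ) : ℝ)⁻¹ := by
    have ht := (tendsto_pow_prime_pow_padicComplex (p := 3) hlt₀).sub_const 1
    rw [sub_self] at ht
    have hev := (Metric.tendsto_nhds.1 ht) _ (by positivity : (0 : ℝ) < ((3 : ℕ) : ℝ)⁻¹)
    obtain ⟨k, hk⟩ := hev.exists
    exact ⟨k, by simpa only [dist_zero_right] using hk⟩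
  have hn₁ : 0 < 3 ^ k * m₀ := Nat.mul_pos (pow_pos (by norm_num) k) hm₀
  have hunr₁ : ∀ v : HeightOneSpectrum (𝓞 K), (χ₀ ^ 3 ^ k).IsUnramifiedAt v :=
    fun v ↦ isUnramifiedAt_pow' (hunr₀ v) _
  have hχ₁ := hasInfinityType_pow_range hχ₀ (3 ^ k)
  have hav₁ := isPAdicAvatarOf_pow ι' hav₀ (fun v _ ↦ hunr₀ v) (3 ^ k)
  have hfac₁ := factorsThroughZp_unitsChar_pow κ hfac₀ (3 ^ k)
  have hψ₁γ : (((ψ₀ ^ 3 ^ k) γ : (PadicAlgCl 3)ˣ) : PadicAlgCl 3) =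
      ((ψ₀ γ : (PadicAlgCl 3)ˣ) : PadicAlgCl 3) ^ 3 ^ k := by
    rw [ContinuousMonoidHom.pow_apply, Units.val_pow_eq_pow_val]
  have hu : ‖((((ψ₀ ^ 3 ^ k) γ : (PadicAlgCl 3)ˣ) : PadicAlgCl 3) : ℂ_[3]) - 1‖ < ((3 : ℕ) : ℝ)⁻¹ := by
    rw [hψ₁γ, PadicComplex.coe_eq, map_pow, ← PadicComplex.coe_eq]; exact hk
  have hu1 : (((ψ₀ ^ 3 ^ k) γ : (PadicAlgCl 3)ˣ) : PadicAlgCl 3) ≠ 1 := by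
    rw [hψ₁γ]
    intro h
    apply hne₀ k
    rw [PadicComplex.coe_eq, ← map_pow, h, map_one]
  -- ## 3. The degenerate witness `Q = 0`
  by_cases hQ0 : Q = 0
  · refine ⟨ΩK, 1, 0, hΩK, fun χ n hn hunr hχ r hr hκr ↦ ?_⟩
    have hv := hQ χ n hn hunr hχ r hr hκr
    rw [hQ0] at hv
    have hval := (intSeries_hasValueAt_zero_series (p := 3) (avatarValueAt r γ - 1)).unique hv
    rw [hsiehInterpolationValue_eq_mul_pow_mul h3N f 𝔭 χ n A ΩK C hΩ] at hval
    have hB0 : bdpInterpolationValue 3 f 𝔭 χ n Ω = 0 := by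
      have h4n : 4 * n ≠ 0 := by omega
      rcases mul_eq_zero.1 hval.symm with h | h
      · rw [PadicComplex.coe_eq, map_eq_zero_iff _ (algebraMap (PadicAlgCl 3) ℂ_[3]).injective,
          map_eq_zero_iff _ ι'.symm.injective] at h
        rcases mul_eq_zero.1 h with h' | h'
        · rcases mul_eq_zero.1 h' with h'' | h''
          · exact absurd h'' fun hC0 ↦ hCC0 (by rw [hCC, hC0, map_zero]; rfl)
          · exact absurd h'' (pow_ne_zero n hΘ0)
        · exact h'
      · exact absurd ((pow_eq_zero_iff h4n).1 h) hΩp0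
    have hB0' : bdpInterpolationValue 3 f 𝔭 χ n ΩK = 0 := by
      have hresc := Three.bdpInterpolationValue_periodRescale 3 f 𝔭 χ n ΩK (Ω / ΩK) (div_ne_zero hΩ hΩK)
      rw [div_mul_cancel₀ Ω hΩK] at hresc
      have hcn : (((Ω / ΩK) ^ 4) ^ n)⁻¹ ≠ 0 := inv_ne_zero (pow_ne_zero _ (pow_ne_zero _ (div_ne_zero hΩ hΩK)))
      rcases mul_eq_zero.1 (hresc ▸ hB0 : (((Ω / ΩK) ^ 4) ^ n)⁻¹ * bdpInterpolationValue 3 f 𝔭 χ n ΩK = 0)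
        with h | h
      · exact absurd h hcn
      · exact h
    rw [hB0', map_zero]
    unfold UnrSeries.HasValueAt
    simp
  -- ## 4. The normalised series `E = ι′⁻¹(C)⁻¹ · Q`
  have hCinv : ‖CC⁻¹‖ ≤ 1 := by rw [norm_inv, hC, inv_one]
  set c₀ : 𝓞_ℂ_[3] := ⟨CC⁻¹, Literature.NumberTheory.LFunctions.Dwork.mem_unitBall.2 hCinv⟩ with hc₀
  have hc₀c : ((c₀ : 𝓞_ℂ_[3]) : ℂ_[3]) = CC⁻¹ := rfl
  set E : PowerSeries 𝓞_ℂ_[3] := PowerSeries.C c₀ * Q with hEdef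
  have hE : ∀ k', ((coeff k' E : 𝓞_ℂ_[3]) : ℂ_[3]) = CC⁻¹ * ((coeff k' Q : 𝓞_ℂ_[3]) : ℂ_[3]) :=
    fun k' ↦ by rw [hEdef, coeff_C_mul, MulMemClass.coe_mul, hc₀c]
  have hE0 : E ≠ 0 := by
    intro h0
    apply hQ0
    have hc : PowerSeries.C c₀ ≠ 0 := by
      intro h
      have : ((c₀ : 𝓞_ℂ_[3]) : ℂ_[3]) = 0 := by
        have := congrArg constantCoeff h
        rw [constantCoeff_C, map_zero] at this
        rw [this]; rfl
      exact inv_ne_zero hCC0 (hc₀c ▸ this)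
    exact (mul_eq_zero.1 h0).resolve_left hc
  -- `E`'s values at range points
  have hEval : ∀ (χ : HeckeCharacter K) (n : ℕ), 0 < n →
      (∀ v : HeightOneSpectrum (𝓞 K), χ.IsUnramifiedAt v) →
      χ.HasInfinityType (fun _ ↦ (n : ℤ)) (fun _ ↦ -(n : ℤ)) →
      ∀ r : FramedGaloisRep K (PadicAlgCl 3) 1, IsPAdicAvatarOf ι' χ r → FactorsThroughZp κ r →
        IntSeries.HasValueAt E (avatarValueAt r γ - 1)
          (θ ^ n * ((ι'.symm (bdpInterpolationValue 3 f 𝔭 χ n Ω) : PadicAlgCl 3) : ℂ_[3])) := by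
    intro χ n hn hunr hχ r hr hκr
    have h := hasValueAt_of_coeff_eq_mul hE (hasValueAt_normalForm ι' hQ h3N hΩ hn hunr hχ hr hκr)
    rw [← hθ, ← hCC, ← mul_assoc, ← mul_assoc, inv_mul_cancel₀ hCC0, one_mul] at h
    exact h
  -- ## 5′. The twist relations `T_τ Ē = (1+T)^{a′_τ} Ē` for `τ ∈ U_m` (value reciprocity in family form)
  have h1 : ((ι'.symm (1 : ℂ) : PadicAlgCl 3) : ℂ_[3]) = 1 := by rw [map_one]; rfl
  have key : ∀ τ : PadicAlgCl 3 ≃ₐ[ℚ_[3]] PadicAlgCl 3, ∃ a' : ℤ_[3],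
      (∀ ζ : PadicAlgCl 3, ζ ^ m = 1 → τ ζ = ζ) →
      (E.map (PadicComplexInt 3).subtype).map (T τ) =
        PowerSeries.C (1 : ℂ_[3]) *
          ((((binomialSeries ℤ_[3] a').map (R1.toCpInt 3)) * E).map (PadicComplexInt 3).subtype) := by
    intro τ
    by_cases hτ : ∀ ζ : PadicAlgCl 3, ζ ^ m = 1 → τ ζ = ζ
    · have hV1 : ∀ j : ℕ, 0 < j →
          σ τ (bdpInterpolationValue 3 f 𝔭 ((χ₀ ^ 3 ^ k) ^ j) (j * (3 ^ k * m₀)) Ω) =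
            1 * 1 ^ (j * (3 ^ k * m₀)) * ((0 : HeightOneSpectrum (𝓞 K) →₀ ℤ).prod
              fun v k' ↦ ((hasInfinityType_pow_range hχ₁ j).autConj (σ τ)).valueAtUniformizer v ^ k') *
              bdpInterpolationValue 3 f 𝔭 ((hasInfinityType_pow_range hχ₁ j).autConj (σ τ))
                (j * (3 ^ k * m₀)) Ω := by
        intro j hj'
        rw [Finsupp.prod_zero_index, hVRB τ (σ τ) hτ (hστ τ) _ _ (Nat.mul_pos hj' hn₁)
          (fun v ↦ isUnramifiedAt_pow' (hunr₁ v) j) (hasInfinityType_pow_range hχ₁ j) _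
          (isPAdicAvatarOf_pow ι' hav₁ (fun v _ ↦ hunr₁ v) j)
          (factorsThroughZp_unitsChar_pow κ hfac₁ j)]
        ring
      obtain ⟨a', ha'⟩ := exists_twist_of_family ι' hQ h3N hΩ hθ0 hCC0 hKreal (hT τ) (hTτ τ) (hφ τ)
        (hστ τ) (hσK τ) one_ne_zero one_ne_zero hn₁ hunr₁ hχ₁ hV1 hav₁ hfac₁ hu hu1 hE0 hE
      rw [h1] at ha'
      exact ⟨a', fun _ ↦ ha'⟩
    · exact ⟨0, fun h ↦ absurd h hτ⟩
  choose a ha using key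
  -- Tate–Sen (printed fact) ⇒ the twist exponent dies on INERTIA
  have hI : ∀ τ : PadicAlgCl 3 ≃ₐ[ℚ_[3]] PadicAlgCl 3,
      (∀ ζ : PadicAlgCl 3, (∃ k : ℕ, 0 < k ∧ ¬ 3 ∣ k ∧ ζ ^ k = 1) → τ ζ = ζ) → a τ = 0 :=
    Summit.BirchSwinnertonDyer.BirchSwinnertonDyer.Theorems.twistExponent_eq_zero_on_inertia_of_tateSenCharacter
      hTS hm h3m T hT hTτ hE0 (d := fun _ ↦ (1 : ℂ_[3])) (fun _ ↦ one_ne_zero) ha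
  -- ## 6. Exactness on inertia: `T_τ Ē = Ē`
  have hfix : ∀ τ, (∀ ζ : PadicAlgCl 3, (∃ m : ℕ, 0 < m ∧ ¬ 3 ∣ m ∧ ζ ^ m = 1) → τ ζ = ζ) →
      (E.map (PadicComplexInt 3).subtype).map (T τ) = E.map (PadicComplexInt 3).subtype := by
    intro τ hτ
    rw [ha τ (hPI τ hτ), hI τ hτ, binomialSeries_zero, map_one, one_mul, map_one, one_mul]
  -- ## 7. The coefficients of `E` lie in `R₀`: the series `L`
  have hcoefR : ∀ k', ((coeff k' E : 𝓞_ℂ_[3]) : ℂ_[3]) ∈ unrIntegers 3 := fun k' ↦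
    mem_unrIntegers_of_forall_inertia_fixed_family 3 T hT hTτ _
      (R1.norm_coe_padicComplexInt_le_one 3 _) fun τ hτ ↦ by
        have h := congrArg (coeff k') (hfix τ hτ)
        simpa only [coeff_map, ValuationSubring.subtype_apply] using h
  set L : UnrSeries 3 := PowerSeries.mk fun k' ↦ (⟨_, hcoefR k'⟩ : unrIntegers 3) with hL
  have hLE : ∀ k', ((coeff k' E : 𝓞_ℂ_[3]) : ℂ_[3]) = ((coeff k' L : unrIntegers 3) : ℂ_[3]) :=
    fun k' ↦ by rw [hL, coeff_mk]
  -- ## 8. `(T_τ θ)^n = θ^n` on inertia whenever a value of type `n` is non-zero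
  set S : Set ℕ := {n | ∃ (χ : HeckeCharacter K) (r : FramedGaloisRep K (PadicAlgCl 3) 1), 0 < n ∧
    (∀ v : HeightOneSpectrum (𝓞 K), χ.IsUnramifiedAt v) ∧
    χ.HasInfinityType (fun _ ↦ (n : ℤ)) (fun _ ↦ -(n : ℤ)) ∧ IsPAdicAvatarOf ι' χ r ∧
    FactorsThroughZp κ r ∧ bdpInterpolationValue 3 f 𝔭 χ n Ω ≠ 0} with hS
  have hθS : ∀ τ, (∀ ζ : PadicAlgCl 3, (∃ m : ℕ, 0 < m ∧ ¬ 3 ∣ m ∧ ζ ^ m = 1) → τ ζ = ζ) →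
      ∀ n ∈ S, (T τ θ) ^ n = θ ^ n := by
    rintro τ hτ n ⟨χ, r, hn, hunr, hχ, hr, hκr, hB⟩
    -- `r = e₁ ∘ ψ`
    set e₁ := (FramedRep.unitsContinuousMulEquivOfUnique (Fin 1) (PadicAlgCl 3) :
      (PadicAlgCl 3)ˣ →ₜ* GL (Fin 1) (PadicAlgCl 3)) with he₁
    set ψ : absoluteGaloisGroup K →ₜ* (PadicAlgCl 3)ˣ :=
      ((FramedRep.unitsContinuousMulEquivOfUnique (Fin 1) (PadicAlgCl 3)).symm :
        GL (Fin 1) (PadicAlgCl 3) →ₜ* (PadicAlgCl 3)ˣ).comp r with hψ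
    have hre : e₁.comp ψ = r := by rw [he₁, hψ, comp_symm_comp_eq]
    rw [← hre] at hr hκr
    have hτc : Continuous (τ : PadicAlgCl 3 ≃+* PadicAlgCl 3) := continuous_algEquiv τ
    -- the transported range point and its value
    have hunr' : ∀ v : HeightOneSpectrum (𝓞 K), (hχ.autConj (σ τ)).IsUnramifiedAt v :=
      fun v ↦ (hχ.isUnramifiedAt_autConj_iff (σ τ) v).mpr (hunr v)
    have hinf' := hasInfinityType_autConj_of_forall_apply_eq hχ (σ τ) (hσK τ) hKreal
    have hav' := isPAdicAvatarOf_autConj_unitsChar ι' _ hτc (σ τ) (hστ τ) hχ hr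
    have hfac' := factorsThroughZp_map_unitsChar _ hτc κ hκr
    have hv' := hEval _ n hn hunr' hinf' _ hav' hfac'
    rw [avatarValueAt_map_unitsChar _ hτc ψ γ] at hv'
    -- the value at the original point, moved by `T_τ`
    have hv := hEval χ n hn hunr hχ _ hr hκr
    rw [avatarValueAt_unitsChar] at hv
    have hmoved := hasValueAt_map_extension (hT τ) (hφ τ) hv
    have hEφ : E.map (φ τ) = E := by
      apply map_injective (PadicComplexInt 3).subtype Subtype.coe_injective
      rw [map_map_restrict (hφ τ), hfix τ hτ]
    rw [hEφ, map_sub, map_one, hTτ, map_mul, map_pow,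
      extension_coe_symm ι' (hTτ τ) (σ τ) (hστ τ), hVRB τ (σ τ) (hPI τ hτ) (hστ τ) χ n hn hunr hχ _ hr hκr]
      at hmoved
    have heq := hmoved.unique hv'
    have hB' : ((ι'.symm (bdpInterpolationValue 3 f 𝔭 (hχ.autConj (σ τ)) n Ω) : PadicAlgCl 3) :
        ℂ_[3]) ≠ 0 := by
      rw [← hVRB τ (σ τ) (hPI τ hτ) (hστ τ) χ n hn hunr hχ _ hr hκr, PadicComplex.coe_eq,
        map_ne_zero_iff _ (algebraMap (PadicAlgCl 3) ℂ_[3]).injective,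
        map_ne_zero_iff _ ι'.symm.injective, map_ne_zero_iff _ (σ τ).injective]
      exact hB
    exact mul_right_cancel₀ hB' heq
  obtain ⟨g, hgS, hgmem⟩ := exists_nat_generator S
  have hθg : ∀ τ, (∀ ζ : PadicAlgCl 3, (∃ m : ℕ, 0 < m ∧ ¬ 3 ∣ m ∧ ζ ^ m = 1) → τ ζ = ζ) →
      T τ (θ ^ g) = θ ^ g := fun τ hτ ↦ by
    rw [map_pow]; exact pow_eq_pow_of_forall hθ0 (hθS τ hτ) hgmem
  -- ## 9. The new periods
  obtain ⟨β, r, hr, hr1, hβ0, hβr⟩ : ∃ (β : PadicAlgCl 3) (r : ℂ_[3]), r ∈ unrIntegers 3 ∧ ‖r‖ = 1 ∧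
      β ≠ 0 ∧ ∀ n ∈ S, ((β : ℂ_[3]) * r ^ 4) ^ n = θ ^ n := by
    rcases Nat.eq_zero_or_pos g with hg0 | hgpos
    · refine ⟨1, 1, one_mem _, norm_one, one_ne_zero, fun n hn ↦ ?_⟩
      have := hgS n hn
      rw [hg0, zero_dvd_iff] at this
      rw [this, pow_zero, pow_zero]
    · have hmem := mem_fracUnr_of_forall_inertia_fixed_family 3 T hT hTτ (θ ^ g) (hθg)
      obtain ⟨β, r, hr, hr1, hβr⟩ := exists_period_root
        (UnrUnits.forall_exists_padicAlgCl_mul_pow_of_norm_eq_one) hθ0 hgpos hmem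
      have hβ0 : β ≠ 0 := by
        intro h0
        rw [h0, PadicComplex.coe_eq, map_zero, zero_mul, zero_pow hgpos.ne'] at hβr
        exact pow_ne_zero g hθ0 hβr.symm
      exact ⟨β, r, hr, hr1, hβ0, fun n hn ↦ pow_eq_pow_of_dvd hβr (hgS n hn)⟩
  have hιβ : ι' β ≠ 0 := (map_ne_zero_iff _ ι'.injective).2 hβ0
  obtain ⟨ρ, hρ⟩ := IsAlgClosed.exists_pow_nat_eq (ι' β * (16 * (A : ℂ) ^ 2) / ((3 : ℕ) : ℂ))
    (by norm_num : 0 < 4)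
  have hρ0 : ρ ≠ 0 := by
    intro h0
    rw [h0, zero_pow (by norm_num : (4 : ℕ) ≠ 0)] at hρ
    exact (div_ne_zero (mul_ne_zero hιβ (mul_ne_zero (by norm_num) (pow_ne_zero 2 hA')))
      (by norm_num)) hρ.symm
  have hΘ' : (((3 : ℕ) : ℂ) / (16 * (A : ℂ) ^ 2)) * (Ω / (Ω / ρ)) ^ 4 = ι' β := by
    have h1 : Ω / (Ω / ρ) = ρ := by field_simp
    have h3 : ((3 : ℕ) : ℂ) ≠ 0 := by norm_num
    have h16 : (16 * (A : ℂ) ^ 2) ≠ 0 := mul_ne_zero (by norm_num) (pow_ne_zero 2 hA')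
    rw [h1, hρ]
    field_simp
  have hru : IsUnit (⟨r, hr⟩ : unrIntegers 3) := (unrIntegers.isUnit_iff_norm_eq_one _).2 hr1
  -- ## 10. Hsieh's display with `C = 1` for the `R₀`-frame `(Ω/ρ, r, L)`
  have hrr : (((hru.unit : (unrIntegers 3)ˣ) : unrIntegers 3) : ℂ_[3]) = r := by
    rw [IsUnit.unit_spec]
  have hdisp : ∀ (χ : HeckeCharacter K) (n : ℕ), 0 < n →
      (∀ v : HeightOneSpectrum (𝓞 K), χ.IsUnramifiedAt v) →
      χ.HasInfinityType (fun _ ↦ (n : ℤ)) (fun _ ↦ -(n : ℤ)) →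
      ∀ r' : FramedGaloisRep K (PadicAlgCl 3) 1, IsPAdicAvatarOf ι' χ r' → FactorsThroughZp κ r' →
        L.HasValueAt (avatarValueAt r' γ - 1)
          (((ι'.symm (hsiehInterpolationValue 3 f 𝔭 χ n A (Ω / ρ) 1) : PadicAlgCl 3) : ℂ_[3]) *
            (((hru.unit : (unrIntegers 3)ˣ) : unrIntegers 3) : ℂ_[3]) ^ (4 * n)) := by
    intro χ n hn hunr hχ r' hr' hκr'
    rw [← IntSeries.hasValueAt_iff_of_coeff_eq hLE]
    have hv := hEval χ n hn hunr hχ r' hr' hκr'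
    have htarget : ((ι'.symm (hsiehInterpolationValue 3 f 𝔭 χ n A (Ω / ρ) 1) : PadicAlgCl 3) : ℂ_[3]) *
        (((hru.unit : (unrIntegers 3)ˣ) : unrIntegers 3) : ℂ_[3]) ^ (4 * n) =
        θ ^ n * ((ι'.symm (bdpInterpolationValue 3 f 𝔭 χ n Ω) : PadicAlgCl 3) : ℂ_[3]) := by
      rw [hsiehInterpolationValue_eq_mul_pow_mul h3N f 𝔭 χ n A (Ω / ρ) 1 hΩ, hΘ', one_mul,
        coe_symm_mul, coe_symm_pow, ι'.symm_apply_apply, hrr]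
      by_cases hB : bdpInterpolationValue 3 f 𝔭 χ n Ω = 0
      · rw [hB, map_zero, PadicComplex.coe_zero, mul_zero, zero_mul, mul_zero]
      · have hnS : n ∈ S := ⟨χ, r', hn, hunr, hχ, hr', hκr', hB⟩
        rw [← hβr n hnS, mul_pow, ← pow_mul]
        ring
    rw [htarget]
    exact hv
  -- ## 11. Castella's display (x11b3's glue: the real monomial absorbed by the complex period)
  obtain ⟨ΩK₁, hΩK₁, hBDP⟩ :=
    Three.exists_isBDPLFunction_of_hsiehDisplay ι' 𝔭 κ γ f h3N hA (div_ne_zero hΩ hρ0)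
      (((hru.unit : (unrIntegers 3)ˣ) : unrIntegers 3) : ℂ_[3]) L hdisp
  exact ⟨ΩK₁, hru.unit, L, hΩK₁, hBDP⟩

end Summit.BirchSwinnertonDyer.BirchSwinnertonDyer.Theorems.MordellShaFreeCutThreeAdicHsiehDescentOfValueReciprocity

end
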